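import Summits.HodgeConjecture.HodgeCM.PerL34.GodementHyperbolic_1

/-! PORT of `HodgeCM/PerL34/GodementHyperbolic.lean` (HodgeCMPerL run 82) — part 2: continuation of `Summits.HodgeConjecture.HodgeCM.PerL34.GodementHyperbolic_1` (split at a top-level declaration boundary by port_pkg.py; scope re-opened below; declarations unchanged). -/

-- port_pkg: scope re-opened for this part (file-level context, then the namespace/section stack open at the cut)
open scoped NNReal Matrix MatrixGroups
open NumberField IsDedekindDomain Literature.NumberTheory Literature.NumberTheory.Automorphic
open HodgeCM.Adelic Literature.AlgebraicGeometry.ShimuraVarieties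
namespace HodgeCM.PerL34.Godement
section Hyperbolic
variable (L : Type) [Field L] [NumberField L] [IsCMField L]
local notation "𝔸L" => AdeleRing (𝓞 L) L
/-- **Godement's criterion is sharp for non-degenerate forms**: the adelic quotient of the unitary
group of the hyperbolic plane over any CM field is not compact. -/
theorem not_compactSpace_hyperbolicPlane :
    ¬ CompactSpace (adelicUnitaryGroup L (hyperbolicPlane L) ⧸ adelicUnitaryRat L (hyperbolicPlane L)) := by
  refine not_compactSpace_of_heightCollapse L (hyperbolicPlane L) (ξ₀ := Pi.single 0 1)
    (by simp) (fun ε hε => ?_)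
  -- the real scalar idele `z(1/2)` has norm `(1/2)^[L:ℚ] < 1`
  have h2 : (2⁻¹ : ℝ≥0) ≠ 0 := inv_ne_zero two_ne_zero
  set t₀ : (𝔸L)ˣ := posRealIdele L (Units.mk0 2⁻¹ h2) with ht₀
  have hnorm : IdeleClassGroup.ideleNorm L t₀ = (2⁻¹ : ℝ≥0) ^ Module.finrank ℚ L :=
    ideleNorm_posRealIdele_holds (K := L) _
  have hlt : IdeleClassGroup.ideleNorm L t₀ < 1 := by
    rw [hnorm]
    exact pow_lt_one₀ zero_le (by norm_num) Module.finrank_pos.ne'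
  obtain ⟨m, hm⟩ := exists_pow_lt_of_lt_one hε hlt
  refine ⟨hypTorus L (t₀ ^ m), hypTorus_mem L _, ?_⟩
  rwa [vecHeight_hypTorus_single, map_pow]

end Hyperbolic

end HodgeCM.PerL34.Godement

/-- **The non-degenerate variant of `PrintFact_unitaryCompact` is FALSE**: anisotropy cannot be weakened to
`det H ≠ 0` — witness `L = ℚ(ζ₇)` (`HodgeCM.cyclo7`), `n = 2`, `H` the hyperbolic plane `(0 1; 1 0)`. -/
theorem HodgeCM.not_printFact_unitaryCompact_nondegenerate :
    ¬ ∀ (L : CMField) (n : ℕ) (H : Matrix (Fin n) (Fin n) L),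
      (∀ i j, Literature.AlgebraicGeometry.ShimuraVarieties.conjRingHomK L (H i j) = H j i) →
      H.det ≠ 0 → AdelicQuotientCompact L H := by
  intro h
  have hdet : (HodgeCM.PerL34.Godement.hyperbolicPlane (L := HodgeCM.cyclo7)).det ≠ 0 := by
    rw [HodgeCM.PerL34.Godement.det_hyperbolicPlane]; norm_num
  exact HodgeCM.PerL34.Godement.not_compactSpace_hyperbolicPlane (L := HodgeCM.cyclo7)
    (h HodgeCM.cyclo7 2 _ (HodgeCM.PerL34.Godement.hyperbolicPlane_isHermitian (L := HodgeCM.cyclo7)) hdet)
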